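import Summits.MatrixMultiplication.OmegaCensus.STPPSmallPatternKernelInvariant
import Summits.MatrixMultiplication.OmegaCensus.STPPSmallPatternCriteria
import Mathlib.Data.Fin.Tuple.Sort

/-!
# ω-census, small STPP pattern `(2,1,1)^k`: kernel search — reflection through Def. 5.1

HONEST FRAMING (pub-omega census; verbatim): lottery ticket; floor = certified bounds/negative ranges.
Census STRUCTURE bookkeeping of the STPP track (seat pub-omega-stpp-3, gen 23; STRUCTURE row B5, the threshold column
`T1(H) = max {k : (2,1,1)^k ⊆ H}` — its LOWER sides as kernel theorems), not progress on `ω`: small patterns in small groups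
bound no exponent.

Third reflection file for `STPPSmallPatternKernelSearch.lean`; the theorem the per-group files use is
`not_exists_isSTPP_211_of_search`:

> if `search E.g K chunks = true` (a `decide +kernel` evaluation), the first-level chunks of every listed representative cover
> all codes, and every nonzero `d` is carried into the representative list by an injective additive map from `auts` (for `ℤ/n`:
> multiplication by units; both side conditions are kernel decisions), then `G` admits NO STPP family (CKSU Def. 5.1, tree
> `IsSTPP`) of `K` triples with `|Aᵢ| = 2`, `|Bᵢ| = |Cᵢ| = 1`.

Proof.  §7 (cont.) along the branch of a normal-form solution the search cannot answer `true`: its `c`, `p`, `q` codes have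
clear forbidden bits (invariant), both room tests pass, the child state satisfies the invariant again (`child_false`,
`level_false`, `below_false`, `start_false`), so the chunk containing the code of `c₁` answers `false`.  §8 every solution has
a normal form: translate (`Bᵢ = {0}` is the criterion's own normalisation; here `c₀ = 0`, `0 ∈ A₀`), apply the covering
automorphism, sort the indices by the code of `c` (`Tuple.sort`), orient the pairs.  §9 = the criterion `exists_isSTPP_211_iff`.

References: H. Cohn, R. Kleinberg, B. Szegedy, C. Umans, *Group-theoretic algorithms for matrix multiplication*, FOCS 2005
(arXiv:math/0511460), Def. 5.1.  Record: pub-omega HOME `pub-omega-stpp-3-g23/` (engine mirror `k211v3.py`, counts, kernel timings).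
-/

open Literature.Computability.AlgebraicComplexity

namespace Summit.MatrixMultiplication.OmegaCensus

namespace STPP211Neg

section Main

variable {G : Type} [AddCommGroup G] {E : GEnc G} {K : ℕ} {p q c : Fin K → G}

/-! ## 7 (continued). The branch of a solution is never refuted -/

/-- Boolean shape of `child`. -/
theorem or3_eq_false {A B C : Bool} (hA : A = true) (hB : B = true) (hC : C = false) :
    (!A || (!B || C)) = false := by
  subst hA hB hC; rfl

/-- THE CHILD OF THE SOLUTION'S BRANCH IS NOT REFUTED: both room tests pass and the continuation, fed with a state
satisfying the invariant for `m + 1` triples, answers `false`. -/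
theorem child_false (hM : ModelD p q c) (hNF : NF E p q c) {m r : ℕ} (hmr : m + 1 + r = K) (im : Fin K)
    (him : im.val = m) {S : St} (hS : InvM E p q c m S) {Wc Uc CmC : ℕ}
    (hWc : MSub E Wc fun z => ∃ l : Fin K, l.val < m ∧ ∃ y, InA p q l y ∧ z = y - c l + c im)
    (hUc : MSub E Uc fun z => ∃ i : Fin K, i.val < m ∧ ∃ u, InA p q i u ∧ z = u - c im)
    (hCmC : MSub E CmC fun z => ∃ j : Fin K, j.val < m ∧ z = c j - c im) {k : St → Bool}
    (hk : ∀ S', InvM E p q c (m + 1) S' → S'.last = E.enc (c im) → k S' = false) :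
    child E.g S r (E.enc (c im)) (E.enc (p im)) (E.enc (q im)) Wc Uc CmC k = false := by
  have hS' := invM_childSt hNF im him hS hWc hUc hCmC
  rw [child_eq]
  refine or3_eq_false ?_ ?_ (hk _ hS' rfl)
  · -- room for the future c's
    refine hasBits_future_c (E := E) hM hNF hmr im him 0 (fun j hj => ?_) (Nat.zero_le _)
    apply testBit_full_xor
    rw [lor_eq, Nat.testBit_lor, hS'.fc_free hM j (by omega), testBit_lowMask_land, Bool.false_or, add_eq']
    have := hNF.1 im j (by rw [Fin.lt_def, him]; exact hj)
    simpa using this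
  · -- room for the future pairs
    refine hasBits_future_pairs (E := E) hM hmr (fun j hj z hz => ?_)
    unfold childRoom
    apply testBit_full_xor
    rw [lor_eq, Nat.testBit_lor, hS'.u_free hM j (by omega) hz, hS'.e_free hM j hz]; rfl

/-- ONE LEVEL OF THE SOLUTION'S BRANCH IS NOT REFUTED (`m ≥ 1` triples placed, the `m`-th one next, its `c`-code
outside the chunk exclusion `x1`). -/
theorem level_false (hM : ModelD p q c) (hNF : NF E p q c) {m r : ℕ} (hmr : m + 1 + r = K) (im : Fin K)
    (him : im.val = m) (ip : Fin K) (hip : ip.val + 1 = m) {S : St} (hS : InvM E p q c m S)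
    (hlast : S.last = E.enc (c ip)) {x1 : ℕ} (hx1 : x1.testBit (E.enc (c im)) = false) {k : St → Bool}
    (hk : ∀ S', InvM E p q c (m + 1) S' → S'.last = E.enc (c im) → k S' = false) :
    level E.g S r x1 k = false := by
  rw [level_eq]
  -- the free-c mask contains every future c, in particular c_m
  have hfree : ∀ j : Fin K, m ≤ j.val → (freeCOf E.g S).testBit (E.enc (c j)) = true := by
    intro j hj
    unfold freeCOf
    apply testBit_full_xor
    rw [lor_eq, Nat.testBit_lor, hS.fc_free hM j hj, testBit_lowMask_land, Bool.false_or, add_eq', hlast]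
    have := hNF.1 ip j (by rw [Fin.lt_def]; omega)
    simpa using this
  cases h : allBits (freeCOf E.g S) _ (freeCOf E.g S)
  · rfl
  exfalso
  have hb := allBits_spec _ _ _ le_rfl h (E.enc (c im)) (hfree im (le_of_eq him.symm))
  rw [hx1, Bool.false_or, hasBits_future_c (E := E) hM hNF hmr im him (E.enc (c im) + 1)
    (fun j hj => hfree j (le_of_lt hj)) le_rfl] at hb
  simp only [Bool.not_true, Bool.false_or] at hb
  -- hb : cBody … (enc c_m) = true
  unfold cBody at hb
  have hpfree : (Nat.xor E.g.full (mcOf E.g S (E.enc (c im)))).testBit (E.enc (p im)) = true :=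
    testBit_full_xor E _ (hS.mc_free hM im him (inA_p im))
  rw [beq_zero_eq_false_of_testBit hpfree, Bool.false_or] at hb
  have hp := allBits_spec _ _ _ le_rfl hb _ hpfree
  have hqfree : (freeQOf E.g S (E.enc (c im)) (E.enc (p im))).testBit (E.enc (q im)) = true := by
    unfold freeQOf
    apply testBit_full_xor
    rw [lor_eq, lor_eq, Nat.testBit_lor, Nat.testBit_lor]
    unfold mcOf dmOf
    rw [hS.mc_free hM im him (inA_q im), hS.dm_free hM im him, testBit_lowMask_land, add_eq']
    have := hNF.2 im
    simp; omega
  have hq := allBits_spec _ _ _ le_rfl hp _ hqfree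
  -- the child of the solution's branch answers false
  have hWc : MSub E (E.g.tr S.W (E.enc (c im))) fun z => ∃ l : Fin K, l.val < m ∧ ∃ y, InA p q l y ∧ z = y - c l + c im :=
    (MSub_tr E hS.hW (c im)).mono fun z ⟨x, ⟨l, hl, y, hy, hx⟩, hz⟩ => ⟨l, hl, y, hy, by rw [hz, hx]⟩
  have hUc : MSub E (E.g.tr S.U (E.g.neg (E.enc (c im)))) fun z => ∃ i : Fin K, i.val < m ∧ ∃ u, InA p q i u ∧
      z = u - c im := by
    rw [E.neg_enc]
    exact (MSub_tr E hS.hU (-c im)).mono fun z ⟨x, ⟨i, hi, hx⟩, hz⟩ => ⟨i, hi, x, hx, by rw [hz, sub_eq_add_neg]⟩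
  have hCmC : MSub E (E.g.tr S.Cm (E.g.neg (E.enc (c im)))) fun z => ∃ j : Fin K, j.val < m ∧ z = c j - c im := by
    rw [E.neg_enc]
    exact (MSub_tr E hS.hCm (-c im)).mono fun z ⟨x, ⟨j, hj, hx⟩, hz⟩ => ⟨j, hj, by rw [hz, hx, sub_eq_add_neg]⟩
  rw [child_false hM hNF hmr im him hS hWc hUc hCmC hk] at hq
  exact Bool.false_ne_true hq

/-- THE SEARCH BELOW A STATE OF THE SOLUTION'S BRANCH ANSWERS `false` (induction on the number of triples left). -/
theorem below_false (hM : ModelD p q c) (hNF : NF E p q c) :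
    ∀ (r m : ℕ) (ip : Fin K) (S : St), m + r = K → ip.val + 1 = m → InvM E p q c m S → S.last = E.enc (c ip) →
      below E.g r S = false := by
  intro r
  induction r with
  | zero => intro m ip S _ _ _ _; rfl
  | succ r ih =>
      intro m ip S hmr hip hS hlast
      have hmK : m < K := by omega
      show level E.g S r 0 (below E.g r) = false
      exact level_false (m := m) (r := r) hM hNF (by omega) ⟨m, hmK⟩ rfl ip hip hS hlast (Nat.zero_testBit _)
        fun S' hS' hl' => ih (m + 1) ⟨m, hmK⟩ S' (by omega) rfl hS' hl'

/-- THE START OF THE SOLUTION'S CHUNK ANSWERS `false`: normal-form solution with `c₀ = 0`, `p₀ = 0`, `q₀ = d`, and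
the chunk exclusion `x1` missing the code of `c₁` (if any). -/
theorem start_false (hM : ModelD p q c) (hNF : NF E p q c) (hK : 0 < K) (hc0 : c ⟨0, hK⟩ = 0) (hp0 : p ⟨0, hK⟩ = 0)
    {x1 : ℕ} (hx1 : ∀ h1 : 1 < K, x1.testBit (E.enc (c ⟨1, h1⟩)) = false) :
    start E.g (K - 1) (E.enc (q ⟨0, hK⟩)) (belowX E.g (K - 1) x1) = false := by
  unfold start
  have h0 : (0 : ℕ) = E.enc (c ⟨0, hK⟩) := by rw [hc0, E.enc_zero]
  have h0' : (0 : ℕ) = E.enc (p ⟨0, hK⟩) := by rw [hp0, E.enc_zero]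
  conv_lhs => rw [show (child E.g St.empty (K - 1) 0 0 (E.enc (q ⟨0, hK⟩)) 0 0 0 (belowX E.g (K - 1) x1)) =
    child E.g St.empty (K - 1) (E.enc (c ⟨0, hK⟩)) (E.enc (p ⟨0, hK⟩)) (E.enc (q ⟨0, hK⟩)) 0 0 0
      (belowX E.g (K - 1) x1) by rw [← h0, ← h0']]
  refine child_false hM hNF (m := 0) (r := K - 1) (by omega) ⟨0, hK⟩ rfl (invM_empty E p q c) (MSub_zero E _)
    (MSub_zero E _) (MSub_zero E _) fun S' hS' hl' => ?_
  -- the continuation `belowX`: nothing left, or one restricted level then `below`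
  unfold belowX
  rcases Nat.eq_zero_or_pos (K - 1) with hK1 | hK1
  · rw [hK1]; rfl
  · obtain ⟨r, hr⟩ : ∃ r, K - 1 = r + 1 := ⟨K - 1 - 1, by omega⟩
    rw [hr]
    show level E.g S' r x1 (below E.g r) = false
    have h1 : 1 < K := by omega
    exact level_false (m := 1) (r := r) hM hNF (by omega) ⟨1, h1⟩ rfl ⟨0, hK⟩ rfl hS' hl' (hx1 h1)
      fun S'' hS'' hl'' => below_false hM hNF r 2 ⟨1, h1⟩ S'' (by omega) rfl hS'' hl''

/-- A `true` search refutes every listed chunk. -/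
theorem start_of_search {g : GC} {k : ℕ} : ∀ {R : List (ℕ × ℕ)}, search g k R = true → ∀ e ∈ R,
    start g (k - 1) e.1 (belowX g (k - 1) e.2) = true := by
  intro R
  induction R with
  | nil => intro _ e he; simp at he
  | cons e' R ih =>
      intro h e he
      rw [search_cons, Bool.and_eq_true] at h
      rcases List.mem_cons.1 he with rfl | he
      · exact h.1
      · exact ih h.2 e he

/-- **REFLECTION, normal-form version.** If the kernel search over `chunks` returns `true` and the chunks of the code
`E.enc (q 0)` cover every code, then no NORMAL-FORM solution `(p, q, c)` of the difference model with `c 0 = 0`,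
`p 0 = 0` exists. -/
theorem not_modelNF_of_search (hK : 0 < K) {chunks : List (ℕ × ℕ)} (hsearch : search E.g K chunks = true)
    (hM : ModelD p q c) (hNF : NF E p q c) (hc0 : c ⟨0, hK⟩ = 0) (hp0 : p ⟨0, hK⟩ = 0)
    (hcov : ∀ y, y < E.g.n → ∃ x1, (E.enc (q ⟨0, hK⟩), x1) ∈ chunks ∧ x1.testBit y = false) : False := by
  -- the code to be covered: that of c₁ if it exists, else 0
  by_cases h1 : 1 < K
  · obtain ⟨x1, hmem, hx1⟩ := hcov (E.enc (c ⟨1, h1⟩)) (E.enc_lt _)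
    have := start_of_search hsearch _ hmem
    rw [start_false hM hNF hK hc0 hp0 (fun _ => hx1)] at this
    exact Bool.false_ne_true this
  · obtain ⟨x1, hmem, -⟩ := hcov 0 (lt_of_le_of_lt (Nat.zero_le _) (E.enc_lt 0))
    have := start_of_search hsearch _ hmem
    rw [start_false hM hNF hK hc0 hp0 (fun h => absurd h h1)] at this
    exact Bool.false_ne_true this

end Main

section NormalForm

variable {G : Type} [AddCommGroup G] {E : GEnc G} {K : ℕ} {p q c : Fin K → G}

/-! ## 8. Symmetries of the model and the normal form -/

/-- Translating the pairs by `−u`, the `c`'s by `−v`, and applying an injective additive map preserves the model. -/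
theorem ModelD.map_sub (hM : ModelD p q c) {G' : Type} [AddCommGroup G'] (f : G →+ G') (hf : Function.Injective f)
    (u v : G) : ModelD (fun i => f (p i - u)) (fun i => f (q i - u)) (fun i => f (c i - v)) := by
  have pull : ∀ i x, InA (fun i => f (p i - u)) (fun i => f (q i - u)) i x → ∃ y, InA p q i y ∧ x = f (y - u) := by
    rintro i x (rfl | rfl)
    · exact ⟨p i, inA_p i, rfl⟩
    · exact ⟨q i, inA_q i, rfl⟩
  refine ⟨fun i h => hM.1 i (sub_left_injective (hf h)), fun i l x hil hx hy => ?_, fun i j l x y hjl hx hy h => ?_⟩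
  · obtain ⟨a, ha, rfl⟩ := pull i x hx
    obtain ⟨b, hb, hab⟩ := pull l _ hy
    have : a = b := sub_left_injective (hf hab)
    subst this
    exact hM.2.1 i l a hil ha hb
  · obtain ⟨a, ha, rfl⟩ := pull i x hx
    obtain ⟨b, hb, rfl⟩ := pull l y hy
    rw [← AddMonoidHom.map_sub, ← AddMonoidHom.map_sub] at h
    have h' := hf h
    exact hM.2.2 i j l a b hjl ha hb (by rw [show a - b = a - u - (b - u) by abel, h']; abel)

/-- Re-indexing along an injective map of the index set preserves the model. -/
theorem ModelD.reindex (hM : ModelD p q c) {K' : ℕ} (σ : Fin K' → Fin K) (hσ : Function.Injective σ) :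
    ModelD (p ∘ σ) (q ∘ σ) (c ∘ σ) :=
  ⟨fun i => hM.1 (σ i), fun i l x hil hx hy => hM.2.1 (σ i) (σ l) x (fun e => hil (hσ e)) hx hy,
    fun i j l x y hjl hx hy => hM.2.2 (σ i) (σ j) (σ l) x y (fun e => hjl (hσ e)) hx hy⟩

/-- Orienting each pair by code preserves the model. -/
theorem ModelD.orient (hM : ModelD p q c) (E : GEnc G) :
    ModelD (fun i => if E.enc (p i) < E.enc (q i) then p i else q i)
      (fun i => if E.enc (p i) < E.enc (q i) then q i else p i) c := by
  have same : ∀ i x, InA (fun i => if E.enc (p i) < E.enc (q i) then p i else q i)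
      (fun i => if E.enc (p i) < E.enc (q i) then q i else p i) i x ↔ InA p q i x := by
    intro i x
    unfold InA
    dsimp only
    split_ifs
    · exact Iff.rfl
    · exact Or.comm
  refine ⟨fun i => ?_, fun i l x hil hx hy => hM.2.1 i l x hil ((same i x).1 hx) ((same l x).1 hy),
    fun i j l x y hjl hx hy => hM.2.2 i j l x y hjl ((same i x).1 hx) ((same l y).1 hy)⟩
  dsimp only
  split_ifs
  · exact hM.1 i
  · exact (hM.1 i).symm

/-- **NORMAL FORM.** A solution of the model can be moved (translations, an automorphism from the covering list, sorting
the indices by the code of `c`, orienting the pairs) to one with increasing `c`-codes, `pᵢ` coded below `qᵢ`, `c₀ = 0`,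
`p₀ = 0` and the code of `q₀` in the list of representatives. -/
theorem exists_normalForm (E : GEnc G) (hM : ModelD p q c) (hK : 0 < K) {dlist : List ℕ} {auts : List (G →+ G)}
    (hinj : ∀ f ∈ auts, Function.Injective f) (hcover : ∀ d : G, d ≠ 0 → ∃ f ∈ auts, E.enc (f d) ∈ dlist) :
    ∃ p' q' c' : Fin K → G, ModelD p' q' c' ∧ NF E p' q' c' ∧ c' ⟨0, hK⟩ = 0 ∧ p' ⟨0, hK⟩ = 0 ∧
      E.enc (q' ⟨0, hK⟩) ∈ dlist := by
  set i0 : Fin K := ⟨0, hK⟩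
  -- step 1: translate and apply the automorphism
  have hd : q i0 - p i0 ≠ 0 := fun h => hM.1 i0 (sub_eq_zero.1 h).symm
  obtain ⟨f, hf, hfd⟩ := hcover _ hd
  have hfi := hinj f hf
  set p1 : Fin K → G := fun i => f (p i - p i0)
  set q1 : Fin K → G := fun i => f (q i - p i0)
  set c1 : Fin K → G := fun i => f (c i - c i0)
  have hM1 : ModelD p1 q1 c1 := hM.map_sub f hfi (p i0) (c i0)
  have hc1 : c1 i0 = 0 := by simp [c1]
  have hp1 : p1 i0 = 0 := by simp [p1]
  -- step 2: sort by the code of c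
  set σ := Tuple.sort (fun i => E.enc (c1 i))
  have hmono : Monotone ((fun i => E.enc (c1 i)) ∘ σ) := Tuple.monotone_sort _
  set p2 := p1 ∘ σ
  set q2 := q1 ∘ σ
  set c2 := c1 ∘ σ
  have hM2 : ModelD p2 q2 c2 := hM1.reindex σ σ.injective
  have hc_inj : Function.Injective (fun i => E.enc (c2 i)) := by
    intro i j h
    by_contra hij
    exact hM2.c_ne hij (E.enc_inj h)
  have hsm : StrictMono (fun i => E.enc (c2 i)) := hmono.strictMono_of_injective hc_inj
  have hσ0 : σ i0 = i0 := by
    -- the index carrying c = 0 has the least code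
    have hi0le : i0 ≤ σ.symm i0 := by rw [Fin.le_def]; exact Nat.zero_le _
    have hle : E.enc (c2 i0) ≤ E.enc (c2 (σ.symm i0)) := hmono hi0le
    have h0 : E.enc (c2 (σ.symm i0)) = 0 := by
      show E.enc (c1 (σ (σ.symm i0))) = 0
      rw [Equiv.apply_symm_apply, hc1, E.enc_zero]
    have h00 : E.enc (c2 i0) = E.enc (c2 (σ.symm i0)) := by omega
    have h3 : i0 = σ.symm i0 := hc_inj h00
    have h4 := congrArg σ h3
    rw [Equiv.apply_symm_apply] at h4
    exact h4
  have hc2 : c2 i0 = 0 := by show c1 (σ i0) = 0; rw [hσ0, hc1]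
  have hp2 : p2 i0 = 0 := by show p1 (σ i0) = 0; rw [hσ0, hp1]
  have hq2 : q2 i0 = f (q i0 - p i0) := by show q1 (σ i0) = _; rw [hσ0]
  -- step 3: orient the pairs
  refine ⟨fun i => if E.enc (p2 i) < E.enc (q2 i) then p2 i else q2 i,
    fun i => if E.enc (p2 i) < E.enc (q2 i) then q2 i else p2 i, c2, hM2.orient E, ⟨fun i j hij => hsm hij, ?_⟩,
    hc2, ?_, ?_⟩
  · intro i
    dsimp only
    split_ifs with h
    · exact h
    · have hne : E.enc (p2 i) ≠ E.enc (q2 i) := fun e => hM2.1 i (E.enc_inj e)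
      omega
  · have h : E.enc (p2 i0) < E.enc (q2 i0) := by
      rw [hp2, E.enc_zero]
      refine Nat.pos_of_ne_zero fun h0 => ?_
      have : q2 i0 = 0 := E.enc_inj (h0.trans E.enc_zero.symm)
      exact hM2.1 i0 (hp2.trans this.symm)
    show (if E.enc (p2 i0) < E.enc (q2 i0) then p2 i0 else q2 i0) = 0
    rw [if_pos h]; exact hp2
  · have h : E.enc (p2 i0) < E.enc (q2 i0) := by
      rw [hp2, E.enc_zero]
      refine Nat.pos_of_ne_zero fun h0 => ?_
      have : q2 i0 = 0 := E.enc_inj (h0.trans E.enc_zero.symm)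
      exact hM2.1 i0 (hp2.trans this.symm)
    show E.enc (if E.enc (p2 i0) < E.enc (q2 i0) then q2 i0 else p2 i0) ∈ dlist
    rw [if_pos h, hq2]; exact hfd

/-! ## 9. The reflection theorems -/

/-- **REFLECTION (difference model).** If the kernel search returns `true` on `chunks`, every code of every listed
representative is covered by a chunk, and every nonzero `d` is moved into the representative list by an injective map of
`auts`, then the `(2,1,1)` difference model has NO solution with `K` triples in `G` (`K ≥ 1`). -/
theorem not_modelD_of_search (E : GEnc G) (hK : 0 < K) {chunks : List (ℕ × ℕ)} (hsearch : search E.g K chunks = true)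
    {dlist : List ℕ} (hchunks : ∀ d ∈ dlist, ∀ y, y < E.g.n → ∃ e ∈ chunks, e.1 = d ∧ e.2.testBit y = false)
    {auts : List (G →+ G)} (hinj : ∀ f ∈ auts, Function.Injective f)
    (hcover : ∀ d : G, d ≠ 0 → ∃ f ∈ auts, E.enc (f d) ∈ dlist) (p q c : Fin K → G) : ¬ ModelD p q c := by
  intro hM
  obtain ⟨p', q', c', hM', hNF, hc0, hp0, hd⟩ := exists_normalForm E hM hK hinj hcover
  refine not_modelNF_of_search hK hsearch hM' hNF hc0 hp0 fun y hy => ?_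
  obtain ⟨e, he, h1, h2⟩ := hchunks _ hd y hy
  refine ⟨e.2, ?_, h2⟩
  rw [← h1]; exact he

/-- The finset form of the model (right-hand side of `exists_isSTPP_211_iff`) implies the disjunctive form. -/
theorem modelD_of_finsetForm [DecidableEq G] (hpq : ∀ i, p i ≠ q i)
    (hD : ∀ i l : Fin K, i ≠ l → Disjoint ({p i, q i} : Finset G) {p l, q l})
    (hX : ∀ i j l : Fin K, j ≠ l → ∀ x ∈ ({p i, q i} : Finset G), ∀ y ∈ ({p l, q l} : Finset G), x - y ≠ c j - c l) :
    ModelD p q c := by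
  have mem : ∀ i x, InA p q i x → x ∈ ({p i, q i} : Finset G) := by
    rintro i x (rfl | rfl) <;> simp
  exact ⟨hpq, fun i l x hil hx hy => Finset.disjoint_left.1 (hD i l hil) (mem i x hx) (mem l x hy),
    fun i j l x y hjl hx hy => hX i j l hjl x (mem i x hx) y (mem l y hy)⟩

/-- **REFLECTION THROUGH DEF. 5.1.** Under the hypotheses of `not_modelD_of_search`, the group `G` admits NO STPP family
(CKSU Def. 5.1, tree `IsSTPP`) of `K` triples with `|Aᵢ| = 2`, `|Bᵢ| = |Cᵢ| = 1` — by the tree's criterion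
`exists_isSTPP_211_iff` (`STPPSmallPatternCriteria.lean`). [cite: CohnKleinbergSzegedyUmans2005, Def. 5.1] -/
theorem not_exists_isSTPP_211_of_search [DecidableEq G] (E : GEnc G) (hK : 0 < K) {chunks : List (ℕ × ℕ)}
    (hsearch : search E.g K chunks = true) {dlist : List ℕ}
    (hchunks : ∀ d ∈ dlist, ∀ y, y < E.g.n → ∃ e ∈ chunks, e.1 = d ∧ e.2.testBit y = false)
    {auts : List (G →+ G)} (hinj : ∀ f ∈ auts, Function.Injective f)
    (hcover : ∀ d : G, d ≠ 0 → ∃ f ∈ auts, E.enc (f d) ∈ dlist) :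
    ¬ ∃ A B C : Fin K → Finset G, IsSTPP A B C ∧
      ∀ i, (A i).card = 2 ∧ (B i).card = 1 ∧ (C i).card = 1 := by
  rw [exists_isSTPP_211_iff]
  rintro ⟨p, q, c, hpq, hD, hX⟩
  exact not_modelD_of_search E hK hsearch hchunks hinj hcover p q c (modelD_of_finsetForm hpq hD hX)

end NormalForm

end STPP211Neg

end Summit.MatrixMultiplication.OmegaCensus
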